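import Summits.BirchSwinnertonDyer.BirchSwinnertonDyer.Theorems.GoldfeldAllTwistsTwoConverseTwinHeegnerIndexRankZero
import Summits.BirchSwinnertonDyer.Rank1Residual.P2.CMRankOneAtTwoHeegnerIndex
import Summits.BirchSwinnertonDyer.BirchSwinnertonDyer.Theorems.GoldfeldK12AdditiveTwoConjectureD
import Summits.BirchSwinnertonDyer.BirchSwinnertonDyer.Theorems.GoldfeldK12AdditiveTwoRamifiedHeegner
import HarnessLib

set_option linter.dupNamespace false -- namespace `…BirchSwinnertonDyer.BirchSwinnertonDyer…` is the cell's (D-0017 nested layout)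
set_option autoImplicit false

/-!
# LINE B49, file 2b — `#Ш_an(49a1^{(−q)}) = 𝔮₄₉`: twin″ on the inert prime-twist family as ONE `2`-adic
# valuation of the `L`-free level-`49` Heegner quotient (the formula-axis reading of `X049BirchLemmaEvenDiscr`)

Cell `bsd-goldfeld`, seat `bsd-goldfeld-s1p-c301` (prover, gen 4), `--supports stmt-BirchSwinnertonDyer-19140`
(route decl `Summit.BirchSwinnertonDyer.BirchSwinnertonDyer.Theses.GoldfeldAllTwistsTwoConverse.BSDTwoCMSevenAdditiveRankOne`,
twin″). The item is OPEN mathematics; NOTHING HERE PROVES IT. THEOREMS ONLY. HONEST FRAMING: BSD is not proved by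
any of this.

File 2a (`…TwinHeegnerIndexRankZero`) proved the exact `2`-adic Gross–Zagier index identity with the rank in the
twist for a general `E/ℚ`. Here `E = X₀(49) = cm7` (CM, `L(cm7,1) ≠ 0` by Coates–Li–Tian–Zhai Thm. 1.2 at `R = 1`,
so `L(cm7,1)/Ω = #Ш(cm7)·c(cm7)/#cm7(ℚ)² = twinQuotient cm7` EXACTLY by Burungale–Flach 2024) over `K = ℚ(√−q)`,
`d_K = −4q`, `q` prime with `(q/7) = −1` (`7` split in `K`, the Heegner hypothesis for level `49`):

* `shaAn_eq_x049Quotient_inertPrimeTwist`: for every globally minimal model `W = Cd • X₀(49)^{(d_K)}` of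
  `49a1^{(−q)}` of analytic rank one and THE halvability value `k ∈ {1,2}`,
  `#Ш_an(W) = 𝔮₄₉ := 8·[X₀(49)(K):ℤP]²·#W(ℚ)_tors²/(n·k²·#X₀(49)(K)_tors²·c²·w_K²·twinQuotient cm7·|u|·∏c_ℓ(W))`
  — LINE B49 file 1's `x049HeegnerTwistQuotient K P Dt.c k W Cd.u` verbatim;
* `bsdp_two_iff_x049Quotient_unit_inertPrimeTwist`: with seat c301 gen 2's complete `2`-descent
  (`Ш(W)[2^∞] = 0`, `bsdp_two_iff_shaAn_unit_primeTwist`), **twin″(`W`) = `BSD(W,2)` ⟺ `ord₂ 𝔮₄₉ = 0`** — clause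
  (ii) of `X049BirchLemmaEvenDiscr` at `(q, K, P)`: the FORMULA-axis consumer of the even-discriminant Birch lemma
  (file 3 restates it with file 1's names once that definition file has landed).

Published inputs as the cell's standing cite-tagged binders: Gross–Zagier (`gross_zagier`), Kolyvagin (`kolyvagin`),
GZK over `ℚ`, Modularity (`exists_isNewformOf`), Burungale–Flach 2024 (`bsdTriple_of_hasCM_of_L_one_ne_zero`),
Coates–Li–Tian–Zhai Thm. 1.2 at `R = 1` (`thm12_fullBSD_twist`). No definition, instance, notation, axiom or sorry.

References: B. Gross, D. Zagier, Invent. Math. 84 (1986) Thm. I.(6.3), V.§2 [GrossZagier1986]; L. Cai, J. Shu,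
Y. Tian, ANT 8 (2014) Thm. 1.1 [CaiShuTian2014]; B. Gross (1991) (1.1), Prop. 2.3 [Gross1991]; A. Burungale,
M. Flach (2024) Thm. 1.1, Cor. 2 [BurungaleFlach2024]; J. Coates, Y. Li, Y. Tian, S. Zhai, PLMS 110 (2015) Thm. 1.2
[CoatesLiTianZhai2015]; R. L. Miller, LMS JCM 14 (2011) §1 [Miller2011LMS]; J. H. Silverman, *AEC* (2009) X.4.2,
X.4.9, X.5.4 [SilvermanAEC2009].
-/

noncomputable section

open scoped Classical

open WeierstrassCurve NumberField Literature.NumberTheory Literature.NumberTheory.EllipticCurves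
  Literature.NumberTheory.EllipticCurves.ModularForms
  Literature.NumberTheory.EllipticCurves.Rank1Residual
  Summit.BirchSwinnertonDyer.Rank1Residual.AdditivePotMult
  Summit.BirchSwinnertonDyer.Rank1Residual.P2

namespace Summit.BirchSwinnertonDyer.BirchSwinnertonDyer.Theorems.GoldfeldGoodTwists

/-! ## `E = X₀(49)` over `ℚ(√−q)`: twin″ on the inert prime-twist family as ONE `2`-adic valuation -/

/-- `X₀(49) = cm7` has complex multiplication (`j(cm7) = −3375`, tree theorems `j_cm7`, `hasCM_of_j_eq_neg3375`).
[cite: CoatesLiTianZhai2015, §1 (p. 359, the curve A)] -/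
theorem hasCM_cm7' : cm7.HasCM := hasCM_of_j_eq_neg3375 cm7 j_cm7

/-- **The rank-zero side of `X₀(49)` is exact and `L`-free**: `L(X₀(49),1) ≠ 0` (Coates–Li–Tian–Zhai Thm. 1.2 at
`R = 1`) and `L(X₀(49),1)/Ω = #Ш(X₀(49))·∏c_ℓ/#X₀(49)(ℚ)² = twinQuotient cm7` (Burungale–Flach 2024 Thm. 1.1 +
Cor. 2, every prime including `2`, read in analytic rank `0`: the tree's `P2.twin_centralValue_eq_of_hasCM`).
[cite: BurungaleFlach2024, Thm. 1.1 and Cor. 2 (p. 4)] [cite: CoatesLiTianZhai2015, Thm. 1.2 (p. 359, case r = 0)] -/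
theorem cm7_centralValue_eq_twinQuotient (hBF : bsdTriple_of_hasCM_of_L_one_ne_zero) (hmod : hasEntireLFunction_rat)
    (h12 : CoatesLiTianZhai2015.thm12_fullBSD_twist) :
    cm7.entireLFunction 1 ≠ 0 ∧ cm7.entireLFunction 1 / (cm7.realPeriodRat : ℂ) = (twinQuotient cm7 : ℂ) := by
  have hL := (cm7_L_one_ne_zero_rank_zero_shaFinite h12).1
  exact ⟨hL, (twin_centralValue_eq_of_hasCM hBF hmod cm7 hasCM_cm7' hL).2.2⟩

/-- **`#Ш_an(W) = 𝔮₄₉` for every globally minimal model `W` of `49a1^{(−q)}` of analytic rank one** (`q` prime,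
`(q/7) = −1`, `K` imaginary quadratic with `d_K = −4q`, `P ∈ X₀(49)(K)` the Heegner point of a datum `(Dt, H, ι)`
at level `49`, `W = Cd • X₀(49)^{(d_K)}`): for THE `k ∈ {1,2}` of the halvability bit,
`#Ш_an(W) = 8·[X₀(49)(K):ℤP]²·#W(ℚ)_tors² / (n·k²·#X₀(49)(K)_tors²·c²·w_K²·twinQuotient cm7·|u|·∏c_ℓ(W))` — file 1's
`x049HeegnerTwistQuotient K P Dt.c k W Cd.u` verbatim. Granted Gross–Zagier, Kolyvagin, GZK, Modularity,
Burungale–Flach 2024 and Coates–Li–Tian–Zhai Thm. 1.2 at `R = 1`. [cite: GrossZagier1986, Thm. I.(6.3) and V.§2]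
[cite: BurungaleFlach2024, Thm. 1.1 and Cor. 2 (p. 4)] [cite: Gross1991, (1.1) and Prop. 2.3] -/
theorem shaAn_eq_x049Quotient_inertPrimeTwist (hnf : ModularForms.exists_isNewformOf)
    (h12 : CoatesLiTianZhai2015.thm12_fullBSD_twist) (hBF : bsdTriple_of_hasCM_of_L_one_ne_zero)
    (hGZ : ∀ (N : ℕ) [NeZero N] (W : WeierstrassCurve ℚ) (K : Type) [Field K] [NumberField K],
      gross_zagier N W K)
    (hKo : ∀ (N : ℕ) [NeZero N] (W : WeierstrassCurve ℚ) (K : Type) [Field K] [NumberField K],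
      kolyvagin N W K)
    (hGZK : rank_eq_analyticRank_of_analyticRank_le_one)
    {q : ℕ} (hq7 : jacobiSym q 7 = -1) (K : Type) [Field K] [NumberField K] (hK : IsImaginaryQuadratic K)
    (hdK : NumberField.discr K = -(4 * (q : ℤ)))
    (Dt : ModularParametrizationData cm7 49) (H : HeegnerDatum 49 (NumberField.discr K)) (ι : K →+* ℂ)
    (P : (cm7.baseChange K).toAffine.Point)
    (hP : WeierstrassCurve.Affine.Point.map ι.toRatAlgHom P = heegnerPointComplex Dt H)
    (W : WeierstrassCurve ℚ) [W.IsElliptic] [W.IsGloballyMinimal] (Cd : VariableChange ℚ)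
    (hW : Cd • cm7.quadraticTwist (NumberField.discr K : ℚ) = W) (hr : W.analyticRank = 1) :
    Finite W.sha ∧ (cm7.baseChange K).mordellWeilRank = 1 ∧ ¬ IsOfFinAddOrder P ∧
      ∃ k : ℕ, (k = 1 ∨ k = 2) ∧
        (k = 2 ↔ ∀ y : W.toAffine.Point, ∃ Q : (W.baseChange K).toAffine.Point,
          QuadraticDescent.incl K W y - (2 : ℤ) • Q ∈ AddCommGroup.torsion (W.baseChange K).toAffine.Point) ∧
        shaAn W =
          ((8 * ((AddSubgroup.zmultiples P).index : ℚ) ^ 2 * (W.torsionOrder : ℚ) ^ 2 /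
            (((cm7.baseChange ℝ).numRealComponents : ℚ) * (k : ℚ) ^ 2 *
              ((cm7.baseChange K).torsionOrder : ℚ) ^ 2 * (Dt.c : ℚ) ^ 2 *
              (Units.torsionOrder K : ℚ) ^ 2 * twinQuotient cm7 * |(Cd.u : ℚ)| * (W.tamagawaProduct : ℚ)) : ℚ) :
            ℂ) := by
  have hmod : hasEntireLFunction_rat := hasEntireLFunction_rat_of_exists_isNewformOf hnf
  have hdK' : NumberField.discr K = 4 * (-(q : ℤ)) := by rw [hdK]; ring
  have hH : SatisfiesHeegnerHypothesis 49 K :=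
    satisfiesHeegnerHypothesis_fortyNine_of_discr_eq K hK.1 hdK' (jacobiSym_neg_prime_seven hq7)
  obtain ⟨hLE, hq0⟩ := cm7_centralValue_eq_twinQuotient hBF hmod h12
  exact shaAn_twist_eq_heegnerIndexFormula_two_rankZero cm7 49 K Dt H ι P (hGZ 49 cm7 K) (hKo 49 cm7 K) hGZK hmod
    hK hH hP (Dt.maninConstant_ne_zero_holds) hLE (twinQuotient cm7) hq0 W Cd hW hr

/-- `X₀(49)^{(−4q)} = ⟨2⁻¹, 0, 0, 0⟩ • X₀(49)^{(−q)}`, so a model `W = Cd • X₀(49)^{(d_K)}`, `d_K = −4q`, is a model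
of `49a1^{(−q)}`: `(Cd · ⟨2⁻¹,0,0,0⟩) • ... ` rearranged as `C • W = X₀(49)^{(−q)}`. [cite: SilvermanAEC2009, X.5 Prop. 5.4] -/
theorem exists_smul_eq_quadraticTwist_neg_of_discr {q : ℕ} (K : Type) [Field K] [NumberField K]
    (hdK : NumberField.discr K = -(4 * (q : ℤ))) (W : WeierstrassCurve ℚ) (Cd : VariableChange ℚ)
    (hW : Cd • cm7.quadraticTwist (NumberField.discr K : ℚ) = W) :
    ∃ C : VariableChange ℚ, C • W = cm7.quadraticTwist ((-q : ℤ) : ℚ) := by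
  have htw : cm7.quadraticTwist (NumberField.discr K : ℚ) =
      (⟨(Units.mk0 (2 : ℚ) two_ne_zero)⁻¹, 0, 0, 0⟩ : VariableChange ℚ) • cm7.quadraticTwist ((-q : ℤ) : ℚ) := by
    rw [hdK, show ((-q : ℤ) : ℚ) = ((-(q : ℤ) : ℤ) : ℚ) by push_cast; ring,
      show ((-(4 * (q : ℤ)) : ℤ) : ℚ) = ((4 * (-(q : ℤ)) : ℤ) : ℚ) by push_cast; ring]
    exact quadraticTwist_cm7_four_mul (-(q : ℤ))
  refine ⟨(Cd * ⟨(Units.mk0 (2 : ℚ) two_ne_zero)⁻¹, 0, 0, 0⟩)⁻¹, ?_⟩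
  rw [← hW, htw, smul_smul, smul_smul, mul_assoc, inv_mul_cancel, one_smul]

/-- **TWIN″ ON THE INERT PRIME-TWIST FAMILY AS ONE `2`-ADIC VALUATION OF AN `L`-FREE QUOTIENT.** For `q` prime,
`q ≡ 1 (mod 4)` with `(−7/q) = −1` (inert in `ℚ(√−7)`), `K` imaginary quadratic with `d_K = −4q`, the Heegner point
`P ∈ X₀(49)(K)` of a datum `(Dt, H, ι)` at level `49`, and a globally minimal model `W = Cd • X₀(49)^{(d_K)}` of
`49a1^{(−q)}` with `ord_{s=1} L(W,s) = 1`: `Ш(W/ℚ)[2^∞] = 0` (seat c301 gen 2's complete `2`-descent,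
`bsdp_two_iff_shaAn_unit_primeTwist`), so for THE halvability value `k`,
**`BSD(W, 2) ⟺ ord₂(8 I² t_W²/(n k² t_K² c² w² · twinQuotient cm7 · |u| · c_W)) = 0`** — the item
`BSDTwoCMSevenAdditiveRankOne` at `W` is clause (ii) of LINE B49 (`X049BirchLemmaEvenDiscr`, file 1) at `(q, K, P)`.
[cite: Miller2011LMS, Def. 1.1] [cite: GrossZagier1986, Thm. I.(6.3) and V.§2] [cite: BurungaleFlach2024, Thm. 1.1 and Cor. 2]
[cite: SilvermanAEC2009, Thm. X.4.2(a), Prop. X.4.9] -/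
theorem bsdp_two_iff_x049Quotient_unit_inertPrimeTwist (hnf : ModularForms.exists_isNewformOf)
    (h12 : CoatesLiTianZhai2015.thm12_fullBSD_twist) (hBF : bsdTriple_of_hasCM_of_L_one_ne_zero)
    (hGZ : ∀ (N : ℕ) [NeZero N] (W : WeierstrassCurve ℚ) (K : Type) [Field K] [NumberField K],
      gross_zagier N W K)
    (hKo : ∀ (N : ℕ) [NeZero N] (W : WeierstrassCurve ℚ) (K : Type) [Field K] [NumberField K],
      kolyvagin N W K)
    (hGZK : rank_eq_analyticRank_of_analyticRank_le_one)
    {q : ℕ} [Fact q.Prime] (hq4 : q % 4 = 1) (hq7 : legendreSym q (-7) = -1)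
    (K : Type) [Field K] [NumberField K] (hK : IsImaginaryQuadratic K) (hdK : NumberField.discr K = -(4 * (q : ℤ)))
    (Dt : ModularParametrizationData cm7 49) (H : HeegnerDatum 49 (NumberField.discr K)) (ι : K →+* ℂ)
    (P : (cm7.baseChange K).toAffine.Point)
    (hP : WeierstrassCurve.Affine.Point.map ι.toRatAlgHom P = heegnerPointComplex Dt H)
    (W : WeierstrassCurve ℚ) [W.IsElliptic] [W.IsGloballyMinimal] (Cd : VariableChange ℚ)
    (hW : Cd • cm7.quadraticTwist (NumberField.discr K : ℚ) = W) (hr : W.analyticRank = 1) :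
    ∃ k : ℕ, (k = 1 ∨ k = 2) ∧
      (k = 2 ↔ ∀ y : W.toAffine.Point, ∃ Q : (W.baseChange K).toAffine.Point,
        QuadraticDescent.incl K W y - (2 : ℤ) • Q ∈ AddCommGroup.torsion (W.baseChange K).toAffine.Point) ∧
      (BSDp W 2 ↔
        padicValRat 2 (8 * ((AddSubgroup.zmultiples P).index : ℚ) ^ 2 * (W.torsionOrder : ℚ) ^ 2 /
            (((cm7.baseChange ℝ).numRealComponents : ℚ) * (k : ℚ) ^ 2 *
              ((cm7.baseChange K).torsionOrder : ℚ) ^ 2 * (Dt.c : ℚ) ^ 2 *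
              (Units.torsionOrder K : ℚ) ^ 2 * twinQuotient cm7 * |(Cd.u : ℚ)| * (W.tamagawaProduct : ℚ))) = 0) := by
  have hqj : jacobiSym q 7 = -1 := by rw [jacobiSym_seven_eq_legendreSym_neg_seven hq4, hq7]
  obtain ⟨-, -, -, k, hk12, hkiff, hsha⟩ := shaAn_eq_x049Quotient_inertPrimeTwist hnf h12 hBF hGZ hKo hGZK hqj K hK
    hdK Dt H ι P hP W Cd hW hr
  obtain ⟨C, hC⟩ := exists_smul_eq_quadraticTwist_neg_of_discr K hdK W Cd hW
  obtain ⟨-, -, -, hiff⟩ := bsdp_two_iff_shaAn_unit_primeTwist hGZK hq4 hq7 W C hC hr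
  refine ⟨k, hk12, hkiff, hiff.trans ⟨?_, fun hv => ⟨_, hsha, hv⟩⟩⟩
  rintro ⟨r, hr', hv⟩
  have hrr := Rat.cast_injective (α := ℂ) (hr'.symm.trans hsha)
  rw [← hrr]; exact hv

end Summit.BirchSwinnertonDyer.BirchSwinnertonDyer.Theorems.GoldfeldGoodTwists

end
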